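/-
NEW (pub-hodgecm2, COR-CM cell; p1). Not a port: the one theorem the stage-1 package does not spell out, written over
the ported modules only. Lives at `Summits/HodgeConjecture/CorCM/Assembly/CorCMOfPeriodThmF.lean` in the port kit.
-/
import Summits.HodgeConjecture.CorCM.Assembly.CorCM
import Summits.HodgeConjecture.CorCM.StubTree.Qw8MilneZero
import Summits.HodgeConjecture.CorCM.Proofs.Pohlmann.WeightHodge
import Summits.HodgeConjecture.CorCM.StubTree.Combinatorics

/-!
# COR-CM with the FACE PERIOD THEOREM as the only non-standard hypothesis

The stage-1 package's headline `Assembly.COR_CM_of_openInputsGeometric` (package only; not ported, ruling R3) takes the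
theta-REALISATION over a rank-four face (`Universe.RealisationExistsFace`, the automorphic content of rfwf v3 §4.2) and
derives the period theorem over `F` from it (`StubTree.periodThmF_holds`). For the stage-2 interface the natural binder
is the period STATEMENT itself — `Universe.PeriodThmF` (rfwf v3 Thm 4.1 `t:per` = PerL v5 Thm 4.4 transposed to faces;
`Geometry/Statements.lean`): it is exactly what the surface criterion consumes, and it is implied by the realisation
(`Assembly.periodThmF`). This file records that form:

* `Assembly.hc_cm_of_periodThmF` — `ModelAxioms → PeriodThmF → N1–N4 → F2, F4–F7 → HC_CM`, the composite
  `hc_cm_of (w_rk4_of PeriodThmF prop22 landherr pms_dim admissible) (faceReduction_holds pohlmann qw8) lemma81`,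
  every ingredient a KERNEL theorem of the ported modules (`Universe.surfaceCriterion_holds` (Proofs/SurfaceCriterion), `landherr_exists_proof` (Proofs/Landherr),
  `StubTree.admissible_exists`, `Universe.pohlmannSpan_of_facts`, `Universe.qw8Sufficiency_of_geometricFacts`,
  `StubTree.faceReduction_holds`, `StubTree.lemma81_holds`);

No statement of the stage-1 interface is restated; `PerL` does not occur (it ranges over sextic fields and their
degree-24/48 closures and never meets the faces `W_RK4` needs — see the cell's CHAIN-MAP, arrow 1).
-/

noncomputable section

namespace Summit.HodgeConjecture.CorCM

namespace Assembly

open Universe StubTree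

variable (U : Universe)

/-- **COR-CM from the period theorem over `F`.** For a geometric universe `U` satisfying the 28 model facts
`ModelAxioms`, the nine textbook facts N1–N4 (`Fact_cupExterior`, `Fact_cup_hodge`, `Fact_pull_H0`, `Fact_hodge_F0`),
F2, F4–F7 (`Fact_factorActDescends`, `Fact_cupAlg`, `Fact_cupAssoc`, `Fact_weightDual`, `Fact_gysin`), the period
theorem over every Galois CM field `F` with `[F:ℚ] ≥ 6` and every rank-four face (`PeriodThmF`, rfwf v3 Thm 4.1) implies
the Hodge conjecture for every CM abelian variety of `U` (`HC_CM`): period theorem ⟹ (surface criterion rfwf Prop 2.2,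
Landherr, `dim P_Γ = 2`, rfwf Lemma 2.1) `W^{RK4}` ⟹ (Pohlmann's span theorem + [QW8] Thm 2.5, both kernel over the
facts) Hodge conjecture for products `∏ A_{(F,Θ_j)}` ⟹ (rfwf Lemma 8.2, kernel over M14) `HC_CM`. -/
theorem hc_cm_of_periodThmF (M : U.ModelAxioms) (hF : U.PeriodThmF)
    (hN1 : U.Fact_cupExterior) (hN2 : U.Fact_cup_hodge) (hN3 : U.Fact_pull_H0) (hN4 : U.Fact_hodge_F0)
    (h2 : U.Fact_factorActDescends) (h4 : U.Fact_cupAlg) (h5 : U.Fact_cupAssoc) (h6 : U.Fact_weightDual)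
    (h7 : U.Fact_gysin) : U.HC_CM :=
  hc_cm_of U
    (w_rk4_of U hF (Universe.surfaceCriterion_holds M) landherr_exists_proof M.pms_dim admissible_exists)
    (faceReduction_holds U (U.pohlmannSpan_of_facts M hN1 hN2 hN3 hN4)
      (U.qw8Sufficiency_of_geometricFacts M hN1 hN2 hN3 hN4 h2 h4 h5 h6 h7))
    (lemma81_holds U M)

end Assembly

end Summit.HodgeConjecture.CorCM

end
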